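import Summits.PneNP.PneNP.Theses.HeisenbergSparsestCut
import Literature.Computability.Complexity.PromiseProofs
import Literature.Computability.Complexity.LabelCover

/-!
# Birth skeleton for the piece `SosOptimalForSparsestCut` (stmt-PneNP-18995)

Line "UG dichotomy": SOS optimality for non-uniform sparsest cut follows from
(1) a Raghavendra-type DICHOTOMY for sparsest cut — for every constant `C ≥ 1`, either the gap
    problem `Gap_C` is UNIQUE-GAMES-hard (for some completeness/soundness `1-η`, `δ` and every label
    size `W`, `UG_W(η,δ) ≤ₚ Gap_C`; the Chawla–Krauthgamer–Kumar–Rabani–Sivakumar / Khot–Vishnoi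
    reduction gives this branch outright, doi:10.1007/s00037-006-0210-9, arXiv:1305.4581), or a
    fixed Lasserre degree has bounded integrality ratio on every instance (the SOS branch, cf.
    Raghavendra doi:10.1145/1374376.1374414 for Max-CSPs) — and
(2) the PromiseP-form of the Unique Games Conjecture ("unique games are not polynomial-time
    solvable": for all `η, δ > 0` some label size `W` has `UG_W(η,δ) ∉ PromiseP`),
by closure of `PromiseP` under promise reductions (`mem_PromiseP_of_polyTimeReducible_holds`).
Unique games are typed inline as label cover instances (tree `LabelCoverInstance`) all of whose
projections are permutations of `[W]`, with completeness `1-η` and soundness `δ`.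
-/

set_option linter.dupNamespace false

namespace Summit.PneNP.PneNP.Cruxes.NoConstantApproxSparsestCut.BirthSosOptimalForSparsestCut

open Summit.PneNP.PneNP.Theses.HeisenbergSparsestCut
open Literature.Computability.Complexity

/-- The unique-games gap problem `UG_W(η, δ)`: well-formed label-cover instances over `[W]` whose
projections are permutations; YES = some assignment satisfies `≥ (1-η)·m` constraints, NO = every
assignment satisfies `< δ·m`. (Inline; Khot 2002 / Arora–Barak Def. 22.? conventions of the tree's
`gapLabelCover`.) -/
def ugGap (W : ℕ) (η δ : ℝ) : PromiseProblem :=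
  PromiseProblem.ofEncoding LabelCoverInstance.encoding
    {φ | φ.WellFormed ∧ φ.alphabetSize = W ∧ (∀ K ∈ φ.constraints, K.proj.Perm (List.range W)) ∧
      ∃ a : ℕ → ℕ, (1 - η) * (φ.numConstraints : ℝ) ≤ (φ.satCount a : ℝ)}
    {φ | φ.WellFormed ∧ φ.alphabetSize = W ∧ (∀ K ∈ φ.constraints, K.proj.Perm (List.range W)) ∧
      ∀ a : ℕ → ℕ, (φ.satCount a : ℝ) < δ * (φ.numConstraints : ℝ)}

/-- The gap problem `Gap_C` of the route (same YES / NO_C sets and encoding as the crux). -/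
def gapSparsestCut (C : ℕ) : PromiseProblem :=
  Literature.Computability.Complexity.PromiseProblem.ofEncoding (Literature.Computability.Complexity.encodingNatMatrix.pairBool (Computability.encodingNatBool.pairBool Computability.encodingNatBool)) {p | ∃ S : Finset (Fin p.1.1), 0 < Literature.Computability.Complexity.cutWeight (fun i j => if i < j then p.1.2 j i else p.1.2 i j) S ∧ Literature.Computability.Complexity.cutWeight (fun i j => if i < j then p.1.2 i j else p.1.2 j i) S * p.2.2 ≤ p.2.1 * Literature.Computability.Complexity.cutWeight (fun i j => if i < j then p.1.2 j i else p.1.2 i j) S} {p | ∀ S : Finset (Fin p.1.1), 0 < Literature.Computability.Complexity.cutWeight (fun i j => if i < j then p.1.2 j i else p.1.2 i j) S → C * p.2.1 * Literature.Computability.Complexity.cutWeight (fun i j => if i < j then p.1.2 j i else p.1.2 i j) S < Literature.Computability.Complexity.cutWeight (fun i j => if i < j then p.1.2 i j else p.1.2 j i) S * p.2.2}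

/-- Statement of STUB 1 (conjecture-grade; the PromiseP-form of UGC, weaker than UGC ∧ P ≠ NP but itself ≥ the
summit since the UG YES-language is in NP): unique games are not polynomial-time solvable. -/
def WeakUGC : Prop := ∀ η δ : ℝ, 0 < η → 0 < δ → ∃ W : ℕ, ugGap W η δ ∉ PromiseP

/-- Statement of STUB 2 (theorem-grade in its first branch: CKKRS doi:10.1007/s00037-006-0210-9 / Khot–Vishnoi
arXiv:1305.4581; a Raghavendra-type "UG-hard or SOS-easy" dichotomy for non-uniform sparsest cut): for every
`C ≥ 1`, either `Gap_C` is UG-hard or some fixed Lasserre degree has integrality ratio `≤ D` on every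
real-weighted instance (rounding form, verbatim the conclusion of `SosOptimalForSparsestCut`). -/
def UGDichotomy : Prop := ∀ C : ℕ, 1 ≤ C →
    (∃ η δ : ℝ, 0 < η ∧ 0 < δ ∧ ∀ W : ℕ, (ugGap W η δ).PolyTimeReducible (gapSparsestCut C)) ∨
    (∃ (d : ℕ) (D : ℝ), 0 < D ∧ ∀ (m : ℕ) (cap dem : Fin m → Fin m → ℝ), (∀ i j, 0 ≤ cap i j) → (∀ i j, 0 ≤ dem i j) → ∀ E : MvPolynomial ℕ ℝ →ₗ[ℝ] ℝ, Literature.Computability.MetaComplexity.IsPseudoexpectation d E → (∀ i : ℕ, Literature.Computability.MetaComplexity.SatisfiesIdentity d E (Literature.Computability.MetaComplexity.boolAxiom i)) → 0 < ∑ i : Fin m, ∑ j : Fin m, dem i j * E ((MvPolynomial.X (i : ℕ) - MvPolynomial.X (j : ℕ)) ^ 2) → ∃ S : Finset (Fin m), 0 < ∑ i : Fin m, ∑ j : Fin m, dem i j * |(if i ∈ S then (1 : ℝ) else 0) - (if j ∈ S then (1 : ℝ) else 0)| ∧ (∑ i : Fin m, ∑ j : Fin m, cap i j * |(if i ∈ S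 then (1 : ℝ) else 0) - (if j ∈ S then (1 : ℝ) else 0)|) * (∑ i : Fin m, ∑ j : Fin m, dem i j * E ((MvPolynomial.X (i : ℕ) - MvPolynomial.X (j : ℕ)) ^ 2)) ≤ D * (∑ i : Fin m, ∑ j : Fin m, dem i j * |(if i ∈ S then (1 : ℝ) else 0) - (if j ∈ S then (1 : ℝ) else 0)|) * (∑ i : Fin m, ∑ j : Fin m, cap i j * E ((MvPolynomial.X (i : ℕ) - MvPolynomial.X (j : ℕ)) ^ 2)))

/-- STUB 1: weak UGC. -/
theorem stub_weakUGC : WeakUGC := by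
  sorry

/-- STUB 2: the UG dichotomy for `Gap_C`. -/
theorem stub_ugDichotomy : UGDichotomy := by
  sorry

/-- COMPOSITION (kernel-checked, no sorry of its own): the piece from the two stubs. If `Gap_C` is in
`PromiseP`, the UG-hard branch would put some `UG_W(η,δ)` in `PromiseP` (closure under promise
reductions), contradicting weak UGC; so the SOS branch holds, which is the claim. -/
theorem SosOptimalForSparsestCut_of (hU : WeakUGC) (hD : UGDichotomy) : SosOptimalForSparsestCut := by
  intro C hC hmem
  rcases hD C hC with ⟨η, δ, hη, hδ, hred⟩ | h
  · exfalso
    obtain ⟨W, hW⟩ := hU η δ hη hδ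
    exact hW (PromiseProblem.mem_PromiseP_of_polyTimeReducible_holds (hred W) hmem)
  · exact h

/-- The piece from the registered stubs. -/
theorem SosOptimalForSparsestCut_holds_of_stubs : SosOptimalForSparsestCut :=
  SosOptimalForSparsestCut_of stub_weakUGC stub_ugDichotomy

end Summit.PneNP.PneNP.Cruxes.NoConstantApproxSparsestCut.BirthSosOptimalForSparsestCut
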